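import Literature.AlgebraicGeometry.Frobenioids.PrimaryStepsComplete
import Literature.AlgebraicGeometry.Frobenioids.PerfFactorialSupportsWeak
import HarnessLib

/-!
# Frobenioids I, Proposition 4.1 (Primary Steps), parts (ii)–(v), for Frobenioids with WEAKLY
# perf-factorial `Φ` — weak twin of `PrimaryStepsComplete.lean`

Mochizuki, *The geometry of Frobenioids I: the general theory*, Kyushu J. Math. **62** (2008)
293–400, §4, Proposition 4.1 (ii)–(v), statement p. 75–76, proof pp. 76–77
[cite: MochizukiFrdI2008, Prop. 4.1 p.75]. Standing data (p. 75): a Frobenioid `C → F_Φ` (`hF`) of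
perfect and isotropic type; steps `φ : B → A`, `ψ : A → C`, `δ : D → E`, `ε : E → F`, `ι : I → F`.

PROOF-ONLY weak twin of the five statements of `PrimaryStepsComplete.lean` (seat abc-iut-L1-t14) that carry
the §4 standing hypothesis "`Φ` perf-factorial" (Def. 2.4 (i) (a)–(d) as printed): the SAME statements with
that hypothesis REPLACED by the named weakening `IsPerfFactorialWeak` of `PerfFactorialWeak.lean` ((a)–(c)
verbatim + (d_ord), (d_res); cell finding F-L2d2-1: (d) fails for the divisor monoids of the tempered
Frobenioids of [EtTh] §3–§5, where [EtTh] Cor. 3.8 (iii) / Prop. 5.3 invoke [FrdI] Thm. 4.2 (i) / 4.9, whose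
proofs run through Prop. 4.1). Proofs verbatim from the strong file: the categorical translations
(`primaryComposite_condition_iff`, `isCoprimary_iff_forall_dvd`, `exists_coprimary_square`,
`prop41iv_condition_iff`, `prop41v_condition_iff` — hypothesis-free, consumed BY NAME) followed by the weak
monoid statements `IsPerfFactorialWeak.isPrimary_mul_iff_of_isPerfect` / `isPrimary_iff_exists_prime_dvd_iff`
(`PerfFactorialSupportsWeak.lean`), `forall_common_dvd_eq_one_iff_disjoint_supp` /
`mul_dvd_of_forall_common_dvd_eq_one` (`PerfFactorialWeakCoprime.lean`); (d) itself is never used. Names =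
strong names + `_weak`. The printed (strong) case is recovered through `IsPerfFactorial.weak`. Cell abc-iut,
layer L1, seat abc-iut-L1-t11 (tranche «T49-WEAK-MID» of the [FrdI] Thm. 4.9 / Cor. 4.11 (iii)(iv) weak
programme held by seat abc-iut-L1-t14). No new definitions; nothing printed is restated as if corrected;
nothing here bears on [IUTchIII] Cor. 3.12.

* `PreFrobenioid.isPrimaryPreStep_comp_iff_of_isStep_weak` — Prop. 4.1 (ii);
* `PreFrobenioid.disjoint_supp_iff_isCoprimary_weak`, `exists_coprimary_square_of_isCoprimary_weak` —
  Prop. 4.1 (iii) (criterion; cartesian square with the divisor identities);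
* `PreFrobenioid.isPrimaryPreStep_iff_exists_prime_over_weak` / `…_under_weak` — Prop. 4.1 (iv) / (v).
-/

namespace Literature.AlgebraicGeometry.Frobenioids

open CategoryTheory Opposite

universe w v v' u u'

namespace PreFrobenioid

variable {D : Type u} [Category.{v} D] {Φ : Dᵒᵖ ⥤ CommMonCat.{w}}
  {C : Type u'} [Category.{v'} C] {F : C ⥤ ElemFrobenioid Φ}

/-! ### Proposition 4.1 (ii) -/

/-- **Proposition 4.1 (ii)** (FrdI p. 75): for a Frobenioid of perfect and isotropic type with `Φ`
WEAKLY perf-factorial, a primary step `φ : B → A` and a step `ψ : A → C`, the composite `ψ ∘ φ` [and then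
also `ψ`] is primary iff every factorisation `ψ ∘ φ = ψ' ∘ φ'` into steps admits a step
`φ'' : B → A''` and pre-steps `ζ : A'' → A`, `ζ' : A'' → A'` with `φ = ζ ∘ φ''`, `φ' = ζ' ∘ φ''`.
[cite: MochizukiFrdI2008, Prop. 4.1 (ii) p.75] -/
theorem isPrimaryPreStep_comp_iff_of_isStep_weak (hF : IsFrobenioid F) (hperf : IsOfPerfectType F)
    (histr : IsOfIsotropicType F) (hpf : Objectwise (fun M _ => IsPerfFactorialWeak M) Φ) {B A C' : C}
    {φ : B ⟶ A} {ψ : A ⟶ C'} (hφ : IsStep F φ) (hφp : IsPrimaryPreStep F φ) (hψ : IsStep F ψ) :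
    (IsPrimaryPreStep F (φ ≫ ψ) ∧ IsPrimaryPreStep F ψ) ↔
      ∀ ⦃A' : C⦄ (φ' : B ⟶ A') (ψ' : A' ⟶ C'), IsStep F φ' → IsStep F ψ' → φ' ≫ ψ' = φ ≫ ψ →
        ∃ (A'' : C) (φ'' : B ⟶ A'') (ζ : A'' ⟶ A) (ζ' : A'' ⟶ A'),
          IsStep F φ'' ∧ IsPreStep F ζ ∧ IsPreStep F ζ' ∧ φ'' ≫ ζ = φ ∧ φ'' ≫ ζ' = φ' := by
  haveI : IsIso (Base F φ) := hφ.1.2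
  have hY : pull Φ (Base F φ) (Div F ψ) ≠ 1 := fun h => div_ne_one_of_isStep histr hψ
    (pull_injective_of_isIso Φ (Base F φ) (by rw [h, map_one]))
  have hdiv : Div F (φ ≫ ψ) = Div F φ * pull Φ (Base F φ) (Div F ψ) := by
    rw [div_comp_of_isLinear φ hψ.1.1, mul_comm]
  rw [primaryComposite_condition_iff hF histr hφ hψ,
    ← (hpf (baseObj F B)).isPrimary_mul_iff_of_isPerfect (isPerfect_divisorMonoid hF hperf B) hφp.2
      hY, ← hdiv]
  constructor
  · exact fun h => h.1.2
  · intro h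
    refine ⟨⟨IsPreStep.comp F hφ.1 hψ.1, h⟩, hψ.1, ?_⟩
    have h1 : IsPrimary (pull Φ (Base F φ) (Div F ψ)) :=
      h.of_precsim (Precsim.of_dvd (Dvd.intro_left _ hdiv.symm)) hY
    exact (isPrimary_pull_iff _ _).mp h1

/-! ### Proposition 4.1 (iii) -/

/-- **Proposition 4.1 (iii)**, criterion (FrdI p. 75): for steps `ε : E → F`, `ι : I → F` and the
elements `y_ε = ε_*(Div ε)`, `y_ι = ι_*(Div ι)` of `Φ(F)` [characterised by `Base(ε)^* y_ε = Div ε`,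
`Base(ι)^* y_ι = Div ι`], `y_ε`, `y_ι` have disjoint supports [`Supp` of Def. 2.4 (i)(d), taken on the
images in `Φ(F)^pf`] iff `ε`, `ι` are co-primary. [cite: MochizukiFrdI2008, Prop. 4.1 (iii) p.75] -/
theorem disjoint_supp_iff_isCoprimary_weak (hF : IsFrobenioid F) (hperf : IsOfPerfectType F)
    (histr : IsOfIsotropicType F) (hpf : Objectwise (fun M _ => IsPerfFactorialWeak M) Φ) {E I F' : C}
    {ε : E ⟶ F'} {ι : I ⟶ F'} (hε : IsStep F ε) (hι : IsStep F ι)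
    (yε yι : Φ.obj (op (baseObj F F'))) (hyε : pull Φ (Base F ε) yε = Div F ε)
    (hyι : pull Φ (Base F ι) yι = Div F ι) :
    Disjoint (supp (factorMap _ (Perfection.of _ yε))) (supp (factorMap _ (Perfection.of _ yι))) ↔
      ∀ ⦃Z : C⦄ (ζ : Z ⟶ F'), IsPreStep F ζ →
        (∃ (ε' : E ⟶ Z) (ι' : I ⟶ Z), IsPreStep F ε' ∧ IsPreStep F ι' ∧ ε' ≫ ζ = ε ∧ ι' ≫ ζ = ι) →
          IsIso ζ := by
  haveI : IsIso (Base F ε) := hε.1.2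
  haveI : IsIso (Base F ι) := hι.1.2
  have h1 : yε = invDiv F ε hε.1.2 := pull_injective_of_isIso Φ (Base F ε) (by rw [hyε, pull_invDiv])
  have h2 : yι = invDiv F ι hι.1.2 := pull_injective_of_isIso Φ (Base F ι) (by rw [hyι, pull_invDiv])
  rw [h1, h2, isCoprimary_iff_forall_dvd hF histr hε.1 hι.1,
    (hpf (baseObj F F')).forall_common_dvd_eq_one_iff_disjoint_supp (isPerfect_divisorMonoid hF hperf F')]

/-- **Proposition 4.1 (iii)**, cartesian square (FrdI pp. 75–76): co-primary steps `ε : E → F`,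
`ι : I → F` admit pre-steps `ε' : U → E`, `ι' : U → I` with `ε ∘ ε' = ι ∘ ι'`, cartesian in the
category of pre-steps, with `ε_*(ε'_*(Div ε')) = ι_*(Div ι)`, `ι_*(ι'_*(Div ι')) = ε_*(Div ε)`; if
`ε, ι` are primary, so are `ε', ι'`. [cite: MochizukiFrdI2008, Prop. 4.1 (iii) p.75] -/
theorem exists_coprimary_square_of_isCoprimary_weak (hF : IsFrobenioid F) (hperf : IsOfPerfectType F)
    (histr : IsOfIsotropicType F) (hpf : Objectwise (fun M _ => IsPerfFactorialWeak M) Φ) {E I F' : C}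
    {ε : E ⟶ F'} {ι : I ⟶ F'} (hε : IsStep F ε) (hι : IsStep F ι)
    (hcop : ∀ ⦃Z : C⦄ (ζ : Z ⟶ F'), IsPreStep F ζ →
      (∃ (ε' : E ⟶ Z) (ι' : I ⟶ Z), IsPreStep F ε' ∧ IsPreStep F ι' ∧ ε' ≫ ζ = ε ∧ ι' ≫ ζ = ι) →
        IsIso ζ) :
    ∃ (U : C) (ε' : U ⟶ E) (ι' : U ⟶ I), IsPreStep F ε' ∧ IsPreStep F ι' ∧ ε' ≫ ε = ι' ≫ ι ∧
      (∀ ⦃V : C⦄ (a : V ⟶ E) (b : V ⟶ I), IsPreStep F a → IsPreStep F b → a ≫ ε = b ≫ ι →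
          ∃! u : V ⟶ U, u ≫ ε' = a ∧ u ≫ ι' = b) ∧
      (∀ yι : Φ.obj (op (baseObj F F')), pull Φ (Base F ι) yι = Div F ι →
          pull Φ (Base F (ε' ≫ ε)) yι = Div F ε') ∧
      (∀ yε : Φ.obj (op (baseObj F F')), pull Φ (Base F ε) yε = Div F ε →
          pull Φ (Base F (ι' ≫ ι)) yε = Div F ι') ∧
      (IsPrimaryPreStep F ε → IsPrimaryPreStep F ι → IsPrimaryPreStep F ε' ∧ IsPrimaryPreStep F ι') :=
  exists_coprimary_square hF histr hε.1 hι.1 fun _ hdε hdι =>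
    (hpf (baseObj F F')).mul_dvd_of_forall_common_dvd_eq_one (isPerfect_divisorMonoid hF hperf F')
      ((isCoprimary_iff_forall_dvd hF histr hε.1 hι.1).mp hcop) hdε hdι

/-! ### Proposition 4.1 (iv) -/

/-- **Proposition 4.1 (iv)** (FrdI p. 76): for steps `δ : D → E`, `ε : E → F`, `δ` is primary iff there
is `𝔭 ∈ Prime(Φ(F))` such that for every primary step `ε' : E' → F` with `ε'_*(Div ε') ∉ 𝔭`, `ε`
factors through `ε'` by a pre-step iff `ε ∘ δ` does. [cite: MochizukiFrdI2008, Prop. 4.1 (iv) p.76] -/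
theorem isPrimaryPreStep_iff_exists_prime_over_weak (hF : IsFrobenioid F) (hperf : IsOfPerfectType F)
    (histr : IsOfIsotropicType F) (hpf : Objectwise (fun M _ => IsPerfFactorialWeak M) Φ) {D' E F' : C}
    {δ : D' ⟶ E} {ε : E ⟶ F'} (hδ : IsStep F δ) (hε : IsStep F ε) :
    IsPrimaryPreStep F δ ↔
      ∃ 𝔭 : Primes (Φ.obj (op (baseObj F F'))), ∀ ⦃E' : C⦄ (ε' : E' ⟶ F'), IsStep F ε' →
        IsPrimaryPreStep F ε' → (∃ y, pull Φ (Base F ε') y = Div F ε' ∧ y ∉ 𝔭.carrier) →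
          ((∃ ζ : E ⟶ E', IsPreStep F ζ ∧ ζ ≫ ε' = ε) ↔
            ∃ θ : D' ⟶ E', IsPreStep F θ ∧ θ ≫ ε' = δ ≫ ε) := by
  have hδε : IsPreStep F (δ ≫ ε) := IsPreStep.comp F hδ.1 hε.1
  haveI : IsIso (Base F (δ ≫ ε)) := hδε.2
  haveI : IsIso (Base F ε) := hε.1.2
  -- `x_δ + x_ε = x_ε · T` with `T` the transport of `Div δ` to `Φ(F)`
  have hT : invDiv F (δ ≫ ε) hδε.2 =
      invDiv F ε hε.1.2 * pull Φ (inv (Base F (δ ≫ ε))) (Div F δ) := by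
    apply pull_injective_of_isIso Φ (Base F (δ ≫ ε))
    rw [pull_invDiv, map_mul, pull_base_comp_invDiv, ← pull_comp, IsIso.hom_inv_id, pull_id,
      div_comp_of_isLinear δ hε.1.1]
  have hT1 : pull Φ (inv (Base F (δ ≫ ε))) (Div F δ) ≠ 1 := fun h => div_ne_one_of_isStep histr hδ
    (pull_injective_of_isIso Φ (inv (Base F (δ ≫ ε))) (by rw [h, map_one]))
  have hmon := (hpf (baseObj F F')).isPrimary_iff_exists_prime_dvd_iff
    (isPerfect_divisorMonoid hF hperf F') (invDiv F ε hε.1.2) hT1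
  rw [← hT] at hmon
  constructor
  · rintro ⟨-, hprim⟩
    obtain ⟨𝔭, h𝔭⟩ := hmon.mp ((isPrimary_pull_iff _ _).mpr hprim)
    exact ⟨𝔭, (prop41iv_condition_iff hF histr hδ hε 𝔭).mpr h𝔭⟩
  · rintro ⟨𝔭, h𝔭⟩
    exact ⟨hδ.1, (isPrimary_pull_iff _ _).mp
      (hmon.mpr ⟨𝔭, (prop41iv_condition_iff hF histr hδ hε 𝔭).mp h𝔭⟩)⟩

/-! ### Proposition 4.1 (v) -/

/-- **Proposition 4.1 (v)** (FrdI p. 76): for steps `δ : D → E`, `ε : E → F`, `ε` is primary iff there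
is `𝔭 ∈ Prime(Φ(D))` such that for every primary step `δ' : D → E'` with `Div(δ') ∉ 𝔭`, `δ` factors
through `δ'` by a pre-step iff `ε ∘ δ` does. [cite: MochizukiFrdI2008, Prop. 4.1 (v) p.76] -/
theorem isPrimaryPreStep_iff_exists_prime_under_weak (hF : IsFrobenioid F) (hperf : IsOfPerfectType F)
    (histr : IsOfIsotropicType F) (hpf : Objectwise (fun M _ => IsPerfFactorialWeak M) Φ) {D' E F' : C}
    {δ : D' ⟶ E} {ε : E ⟶ F'} (hδ : IsStep F δ) (hε : IsStep F ε) :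
    IsPrimaryPreStep F ε ↔
      ∃ 𝔭 : Primes (Φ.obj (op (baseObj F D'))), ∀ ⦃E' : C⦄ (δ' : D' ⟶ E'), IsStep F δ' →
        IsPrimaryPreStep F δ' → Div F δ' ∉ 𝔭.carrier →
          ((∃ ζ : E' ⟶ E, IsPreStep F ζ ∧ δ' ≫ ζ = δ) ↔
            ∃ θ : E' ⟶ F', IsPreStep F θ ∧ δ' ≫ θ = δ ≫ ε) := by
  haveI : IsIso (Base F δ) := hδ.1.2
  have hde : Div F (δ ≫ ε) = Div F δ * pull Φ (Base F δ) (Div F ε) := by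
    rw [div_comp_of_isLinear δ hε.1.1, mul_comm]
  have he1 : pull Φ (Base F δ) (Div F ε) ≠ 1 := fun h => div_ne_one_of_isStep histr hε
    (pull_injective_of_isIso Φ (Base F δ) (by rw [h, map_one]))
  have hmon := (hpf (baseObj F D')).isPrimary_iff_exists_prime_dvd_iff
    (isPerfect_divisorMonoid hF hperf D') (Div F δ) he1
  rw [← hde] at hmon
  constructor
  · rintro ⟨-, hprim⟩
    obtain ⟨𝔭, h𝔭⟩ := hmon.mp ((isPrimary_pull_iff _ _).mpr hprim)
    exact ⟨𝔭, (prop41v_condition_iff hF histr hδ hε 𝔭).mpr h𝔭⟩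
  · rintro ⟨𝔭, h𝔭⟩
    exact ⟨hε.1, (isPrimary_pull_iff _ _).mp
      (hmon.mpr ⟨𝔭, (prop41v_condition_iff hF histr hδ hε 𝔭).mp h𝔭⟩)⟩

end PreFrobenioid

end Literature.AlgebraicGeometry.Frobenioids
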